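import Summits.QuantumFields.BalabanUV.Beta.D1BFx.GhostHalfCovariant
import Summits.QuantumFields.BalabanUV.Beta.D1BFx.TorusGhostSideZero
import Summits.QuantumFields.BalabanUV.Beta.D1BFx.TorusHodgeWeight

/-!
# Road «BF-x», slot (K), TB5-2c-D′ — the HALF-COVARIANT ghost side ON THE ROAD'S OBJECTS (fine torus, `Qind`, `AXhat`, `Ghat`, `CsqHat`, `N̂`)

Finding F-g7-2 of the road owner (b2b-balaban-beta-d1-p2, gen 7; ruling ρ-g7-5) is the tree theorem
`GhostHalfCovariant.hessT_ghost_halfCovariant` (p244989): under the (R2) bookkeeping of TB5-1 (frozen gauge basis `W₀ = D₀N`, dressed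
tables) the FP-Gram one-loop functional equals `2·hessT(M₀⁻¹; D•ᵀD₀) + 2·hessT(S̃) − hessT(S)` — the HALF-covariant tower plus the coarse
words `2S̃ − S`.  This file is its ROAD INSTANCE (K-END-RECUT-SPEC v1 §4 «TB5-2c-D′»): the abstract objects are specialised to the fine
torus `Site 4 s`, `s = (m+1)·p`, with
* `D₀ := (m+1)•D̂` (`TorusHodgeWeight.Dhat 4 s`, so `D₀ᵀD₀ = (m+1)²•L̂` — the TB4-W normalisation of `TorusGhostSideZero`),
* `Q := Qind m s p` (block indicator, `TorusScalarAveraging`), `c := 1`, `Γ := (a/(m+1)⁴)•1`, so that `M₀ = ÂX` (`AXhat_eq_lap_add_border`),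
* the legs read BY NAME: `ÂX⁻¹ = Ĝ` (`Ghat_mul_AXhat`), `(ÂX·ÂX)⁻¹ = Ĝ·Ĝ` (`inv_AXhat_mul_AXhat`), `(Qind·(ÂXÂX)⁻¹·Qindᵀ)⁻¹ = (m+1)⁻⁴•Ĉsq` (`inv_S0`),
* `N` any basis of `ker Ŝ` (`hrange`, `hinj` — K-TB3b-N), then `N := N̂` (`Nhat_range`, `Nhat_injective`).
The compression sockets are discharged exactly as in `TorusGhostSideZero.hessT_ghost_side_zero` (`Qind_mul_eq_zero_of_range`,
`det_gram_ne_zero_of_injective`, `card_basis_add_card_coarse`, `det_Qind_mul_Qind_transpose_ne_zero`, `det_compressed_lap_sq_ne_zero`,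
`det_AXhat_ne_zero`, `det_S0_ne_zero`).  The gradient jets `Dₛ Dₜ Dₛₜ` stay ARBITRARY (the dictionary step «HALF-WORD ARRAYS» supplies them).

[folklore] finite-dimensional linear algebra; 0 `def`, nothing cited, 0 sorry.  NOT D1, NOT BetaPertH, NOT continuum, NOT Clay.
-/

noncomputable section

namespace Summit.QuantumFields.BalabanUV.Beta.D1BFx.GhostHalfCovariantRoad

open Matrix
open scoped BigOperators
open Literature.MathematicalPhysics.QuantumFieldTheory.Balaban1983to89
open Literature.MathematicalPhysics.QuantumFieldTheory.Balaban1983to89.Beta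
open Summit.QuantumFields.BalabanUV.Beta.D1BFx.MixedVarPackedHess (hessT)
open Summit.QuantumFields.BalabanUV.Beta.D1BFx.GramWeightJets (gram₁)
open Summit.QuantumFields.BalabanUV.Beta.D1BFx.GramWeightJetsMixed (gramMix)
open Summit.QuantumFields.BalabanUV.Beta.D1BFx.GhostHalfCovariant (hessT_ghost_halfCovariant)
open Summit.QuantumFields.BalabanUV.Beta.D1BFx.TorusHodgeWeight (Dhat Dhat_transpose_mul_Dhat)
open Summit.QuantumFields.BalabanUV.Beta.D1BFx.PeriodisedProjector (Ghat AXhat Lhat Shat Ghat_mul_AXhat)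
open Summit.QuantumFields.BalabanUV.Beta.D1BFx.TorusScalarAveraging
open Summit.QuantumFields.BalabanUV.Beta.D1BFx.TorusScalarCoarseGram
open Summit.QuantumFields.BalabanUV.Beta.D1BFx.TorusGhostSideZero (Qind_mul_eq_zero_of_range det_gram_ne_zero_of_injective
  card_basis_add_card_coarse)
open AffineAveraging (box)
open Summit.QuantumFields.BalabanUV.Beta.D1BFx.TorusGaugeBasisMatrix (Nhat)
open Summit.QuantumFields.BalabanUV.Beta.D1BFx.TorusGaugeBasisKernel (Nhat_range Nhat_injective)

variable (m : ℕ) {a : ℝ} {s p : ℕ} [NeZero s] [NeZero p] {ρ : Type*} [Fintype ρ] [DecidableEq ρ]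

/-- [folklore] `((m+1)•D̂)ᵀ((m+1)•D̂) = (m+1)²•L̂` (TB4-W normalisation of the frozen gradient). -/
theorem smul_Dhat_transpose_mul (s : ℕ) [NeZero s] :
    ((((m : ℝ) + 1)) • Dhat 4 s)ᵀ * ((((m : ℝ) + 1)) • Dhat 4 s) = (((m : ℝ) + 1) ^ 2) • Lhat s := by
  rw [Matrix.transpose_smul, Matrix.smul_mul, Matrix.mul_smul, smul_smul, Dhat_transpose_mul_Dhat, pow_two]

/-- [folklore] The tower's zeroth-order matrix in the model's letters: `(m+1)²•L̂ + 1•(Qindᵀ((a/(m+1)⁴)•1)Qind) = ÂX`. -/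
theorem lap_add_border_eq_AXhat (a : ℝ) (hs : s = (m + 1) * p) :
    (((m : ℝ) + 1) ^ 2) • Lhat s + (1 : ℝ) • ((Qind m s p)ᵀ * ((a / ((m : ℝ) + 1) ^ 4) • (1 : Matrix (Site 4 p) (Site 4 p) ℝ)) * Qind m s p)
      = AXhat m a s := by
  rw [one_smul, AXhat_eq_lap_add_border (m := m) a hs]

/-- [folklore] **TB5-2c-D′ — THE HALF-COVARIANT GHOST SIDE ON THE FINE TORUS, for any basis `N` of `ker Ŝ`.**  With `D₀ = (m+1)•D̂`,
`Q = Qind`, `M₀ = ÂX`, tower leg `Ĝ = ÂX⁻¹`, coarse leg `(m+1)⁻⁴•Ĉsq`, and ARBITRARY gradient jets `Dₛ Dₜ Dₛₜ`: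
the (R2) FP-Gram functional of `GhostHalfCovariant.hessT_ghost_halfCovariant` equals
`2·hessT Ĝ (Dₛᵀ D₀) (Dₜᵀ D₀) (Dₛₜᵀ D₀) + 2·hessT ((m+1)⁻⁴•Ĉsq) S̃ₛ S̃ₜ S̃ₛₜ − hessT ((m+1)⁻⁴•Ĉsq) Sₛ Sₜ Sₛₜ`
with the explicit half words `S̃` and full words `S` displayed below (all sandwiches `Qind·ĜĜ·(…)·ĜĜ·Qindᵀ`). -/
theorem hessT_ghost_halfCovariant_torus (ha : 0 < a) (hs : s = (m + 1) * p) (N : Matrix (Site 4 s) ρ ℝ)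
    (hrange : ∀ lam : Site 4 s → ℝ, Shat m s *ᵥ lam = 0 ↔ ∃ c : ρ → ℝ, lam = N *ᵥ c) (hinj : Function.Injective N.mulVec)
    (Dₛ Dₜ Dₛₜ : Matrix (Site 4 s × Fin 4) (Site 4 s) ℝ) :
    let D₀ : Matrix (Site 4 s × Fin 4) (Site 4 s) ℝ := (((m : ℝ) + 1)) • Dhat 4 s
    let L₀ : Matrix (Site 4 s) (Site 4 s) ℝ := (((m : ℝ) + 1) ^ 2) • Lhat s
    let Lₛ := Dₛᵀ * D₀ + D₀ᵀ * Dₛ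
    let Lₜ := Dₜᵀ * D₀ + D₀ᵀ * Dₜ
    let Lₛₜ := Dₛₜᵀ * D₀ + Dₛᵀ * Dₜ + Dₜᵀ * Dₛ + D₀ᵀ * Dₛₜ
    let T₀ : Matrix ρ (Site 4 s × Fin 4) ℝ := Nᵀ * L₀ * D₀ᵀ
    let Tₛ : Matrix ρ (Site 4 s × Fin 4) ℝ := Nᵀ * (Lₛ * D₀ᵀ + L₀ * Dₛᵀ)
    let Tₜ : Matrix ρ (Site 4 s × Fin 4) ℝ := Nᵀ * (Lₜ * D₀ᵀ + L₀ * Dₜᵀ)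
    let Tₛₜ : Matrix ρ (Site 4 s × Fin 4) ℝ := Nᵀ * (Lₛₜ * D₀ᵀ + Lₛ * Dₜᵀ + Lₜ * Dₛᵀ + L₀ * Dₛₜᵀ)
    let G₀ : Matrix ρ ρ ℝ := Nᵀ * (L₀ * L₀) * N
    let Gₛ : Matrix ρ ρ ℝ := Nᵀ * (Lₛ * L₀ + L₀ * Lₛ) * N
    let Gₜ : Matrix ρ ρ ℝ := Nᵀ * (Lₜ * L₀ + L₀ * Lₜ) * N
    let Gₛₜ : Matrix ρ ρ ℝ := Nᵀ * (Lₛₜ * L₀ + Lₛ * Lₜ + Lₜ * Lₛ + L₀ * Lₛₜ) * N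
    let A₀ : Matrix ρ ρ ℝ := (2 : ℝ) • G₀⁻¹
    let Aₛ : Matrix ρ ρ ℝ := -((2 : ℝ) • (G₀⁻¹ * Gₛ * G₀⁻¹))
    let Aₜ : Matrix ρ ρ ℝ := -((2 : ℝ) • (G₀⁻¹ * Gₜ * G₀⁻¹))
    let Aₛₜ : Matrix ρ ρ ℝ := (2 : ℝ) • (-(G₀⁻¹ * Gₛₜ * G₀⁻¹) + G₀⁻¹ * Gₛ * G₀⁻¹ * Gₜ * G₀⁻¹ + G₀⁻¹ * Gₜ * G₀⁻¹ * Gₛ * G₀⁻¹)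
    let W₀ : Matrix (Site 4 s × Fin 4) ρ ℝ := D₀ * N
    let M₀ : Matrix (Site 4 s) (Site 4 s) ℝ := AXhat m a s
    let GG : Matrix (Site 4 s) (Site 4 s) ℝ := Ghat m a s * Ghat m a s
    let Q : Matrix (Site 4 p) (Site 4 s) ℝ := Qind m s p
    let Bₛ : Matrix (Site 4 s) (Site 4 s) ℝ := Dₛᵀ * D₀
    let Bₜ : Matrix (Site 4 s) (Site 4 s) ℝ := Dₜᵀ * D₀
    let Bₛₜ : Matrix (Site 4 s) (Site 4 s) ℝ := Dₛₜᵀ * D₀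
    hessT (W₀ᵀ * (T₀ᵀ * A₀ * T₀) * W₀)⁻¹ (W₀ᵀ * gram₁ T₀ Tₛ A₀ Aₛ * W₀) (W₀ᵀ * gram₁ T₀ Tₜ A₀ Aₜ * W₀)
        (W₀ᵀ * gramMix T₀ Tₛ Tₜ Tₛₜ A₀ Aₛ Aₜ Aₛₜ * W₀)
      = 2 * hessT (Ghat m a s) Bₛ Bₜ Bₛₜ
        + 2 * hessT ((((m : ℝ) + 1) ^ 4)⁻¹ • CsqHat m a p)
            (-(Q * GG * (Lₛ * M₀ + M₀ * Bₛ) * GG * Qᵀ))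
            (-(Q * GG * (Lₜ * M₀ + M₀ * Bₜ) * GG * Qᵀ))
            (-(Q * GG * (Lₛₜ * M₀ + Lₛ * Bₜ + Lₜ * Bₛ + M₀ * Bₛₜ) * GG * Qᵀ)
              + Q * GG * (Lₛ * M₀ + M₀ * Bₛ) * GG * (Lₜ * M₀ + M₀ * Bₜ) * GG * Qᵀ
              + Q * GG * (Lₜ * M₀ + M₀ * Bₜ) * GG * (Lₛ * M₀ + M₀ * Bₛ) * GG * Qᵀ)
        - hessT ((((m : ℝ) + 1) ^ 4)⁻¹ • CsqHat m a p)
            (-(Q * GG * (Lₛ * M₀ + M₀ * Lₛ) * GG * Qᵀ))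
            (-(Q * GG * (Lₜ * M₀ + M₀ * Lₜ) * GG * Qᵀ))
            (-(Q * GG * (Lₛₜ * M₀ + Lₛ * Lₜ + Lₜ * Lₛ + M₀ * Lₛₜ) * GG * Qᵀ)
              + Q * GG * (Lₛ * M₀ + M₀ * Lₛ) * GG * (Lₜ * M₀ + M₀ * Lₜ) * GG * Qᵀ
              + Q * GG * (Lₜ * M₀ + M₀ * Lₜ) * GG * (Lₛ * M₀ + M₀ * Lₛ) * GG * Qᵀ) := by
  intro D₀ L₀ Lₛ Lₜ Lₛₜ T₀ Tₛ Tₜ Tₛₜ G₀ Gₛ Gₜ Gₛₜ A₀ Aₛ Aₜ Aₛₜ W₀ M₀ GG Q Bₛ Bₜ Bₛₜ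
  have hQN : Qind m s p * N = 0 := Qind_mul_eq_zero_of_range m hs N hrange
  have hN : (Nᵀ * N).det ≠ 0 := det_gram_ne_zero_of_injective N hinj
  have hcard : Fintype.card ρ + Fintype.card (Site 4 p) = Fintype.card (Site 4 s) := card_basis_add_card_coarse m hs N hrange hinj
  have hQ : (Qind m s p * (Qind m s p)ᵀ).det ≠ 0 := det_Qind_mul_Qind_transpose_ne_zero (m := m) hs
  have hL0 := smul_Dhat_transpose_mul m s
  have hM0 := lap_add_border_eq_AXhat m a hs
  have hG : IsUnit (Nᵀ * (D₀ᵀ * D₀ * (D₀ᵀ * D₀)) * N).det := by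
    rw [hL0]; exact isUnit_iff_ne_zero.2 (det_compressed_lap_sq_ne_zero m ha hs N hQN hN)
  have hM : IsUnit (D₀ᵀ * D₀ + (1 : ℝ) • ((Qind m s p)ᵀ * ((a / ((m : ℝ) + 1) ^ 4) • (1 : Matrix (Site 4 p) (Site 4 p) ℝ))
      * Qind m s p)).det := by
    rw [hL0, hM0]; exact isUnit_iff_ne_zero.2 (det_AXhat_ne_zero m ha hs).1
  have hS : IsUnit (Qind m s p * ((D₀ᵀ * D₀ + (1 : ℝ) • ((Qind m s p)ᵀ * ((a / ((m : ℝ) + 1) ^ 4)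
      • (1 : Matrix (Site 4 p) (Site 4 p) ℝ)) * Qind m s p)) * (D₀ᵀ * D₀ + (1 : ℝ) • ((Qind m s p)ᵀ * ((a / ((m : ℝ) + 1) ^ 4)
      • (1 : Matrix (Site 4 p) (Site 4 p) ℝ)) * Qind m s p)))⁻¹ * (Qind m s p)ᵀ).det := by
    rw [hL0, hM0]; exact isUnit_iff_ne_zero.2 (det_S0_ne_zero m ha hs)
  have h := hessT_ghost_halfCovariant hcard D₀ Dₛ Dₜ Dₛₜ (Qind m s p) N
    ((a / ((m : ℝ) + 1) ^ 4) • (1 : Matrix (Site 4 p) (Site 4 p) ℝ)) 1 hQN hQ hN hG hM hS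
  dsimp only at h
  rw [hL0, hM0, inv_S0 m ha hs, inv_AXhat_mul_AXhat m ha hs, Matrix.inv_eq_right_inv (Ghat_mul_AXhat (m := m) (a := a) (s := s) ha hs).2]
    at h
  exact h

/-- [folklore] **TB5-2c-D′ ON THE ROAD'S BASIS `N̂`** (`TorusGaugeBasisMatrix.Nhat r (m+1) p`, centre `r ∈ box 4 (m+1)`): the previous theorem with
`hrange := Nhat_range`, `hinj := Nhat_injective`; the only inputs left are the three gradient jets («HALF-WORD ARRAYS»). -/
theorem hessT_ghost_halfCovariant_Nhat {r : Fin (3 + 1) → ℕ} (ha : 0 < a) (hr : r ∈ box (3 + 1) (m + 1))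
    (Dₛ Dₜ Dₛₜ : Matrix (Site 4 ((m + 1) * p) × Fin 4) (Site 4 ((m + 1) * p)) ℝ) :
    let N : Matrix (Site 4 ((m + 1) * p)) _ ℝ := Nhat r (m + 1) p
    let D₀ : Matrix (Site 4 ((m + 1) * p) × Fin 4) (Site 4 ((m + 1) * p)) ℝ := (((m : ℝ) + 1)) • Dhat 4 ((m + 1) * p)
    let L₀ : Matrix (Site 4 ((m + 1) * p)) (Site 4 ((m + 1) * p)) ℝ := (((m : ℝ) + 1) ^ 2) • Lhat ((m + 1) * p)
    let Lₛ := Dₛᵀ * D₀ + D₀ᵀ * Dₛ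
    let Lₜ := Dₜᵀ * D₀ + D₀ᵀ * Dₜ
    let Lₛₜ := Dₛₜᵀ * D₀ + Dₛᵀ * Dₜ + Dₜᵀ * Dₛ + D₀ᵀ * Dₛₜ
    let T₀ := Nᵀ * L₀ * D₀ᵀ
    let Tₛ := Nᵀ * (Lₛ * D₀ᵀ + L₀ * Dₛᵀ)
    let Tₜ := Nᵀ * (Lₜ * D₀ᵀ + L₀ * Dₜᵀ)
    let Tₛₜ := Nᵀ * (Lₛₜ * D₀ᵀ + Lₛ * Dₜᵀ + Lₜ * Dₛᵀ + L₀ * Dₛₜᵀ)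
    let G₀ := Nᵀ * (L₀ * L₀) * N
    let Gₛ := Nᵀ * (Lₛ * L₀ + L₀ * Lₛ) * N
    let Gₜ := Nᵀ * (Lₜ * L₀ + L₀ * Lₜ) * N
    let Gₛₜ := Nᵀ * (Lₛₜ * L₀ + Lₛ * Lₜ + Lₜ * Lₛ + L₀ * Lₛₜ) * N
    let A₀ := (2 : ℝ) • G₀⁻¹
    let Aₛ := -((2 : ℝ) • (G₀⁻¹ * Gₛ * G₀⁻¹))
    let Aₜ := -((2 : ℝ) • (G₀⁻¹ * Gₜ * G₀⁻¹))
    let Aₛₜ := (2 : ℝ) • (-(G₀⁻¹ * Gₛₜ * G₀⁻¹) + G₀⁻¹ * Gₛ * G₀⁻¹ * Gₜ * G₀⁻¹ + G₀⁻¹ * Gₜ * G₀⁻¹ * Gₛ * G₀⁻¹)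
    let W₀ := D₀ * N
    let M₀ := AXhat m a ((m + 1) * p)
    let GG := Ghat m a ((m + 1) * p) * Ghat m a ((m + 1) * p)
    let Q := Qind m ((m + 1) * p) p
    let Bₛ := Dₛᵀ * D₀
    let Bₜ := Dₜᵀ * D₀
    let Bₛₜ := Dₛₜᵀ * D₀
    hessT (W₀ᵀ * (T₀ᵀ * A₀ * T₀) * W₀)⁻¹ (W₀ᵀ * gram₁ T₀ Tₛ A₀ Aₛ * W₀) (W₀ᵀ * gram₁ T₀ Tₜ A₀ Aₜ * W₀)
        (W₀ᵀ * gramMix T₀ Tₛ Tₜ Tₛₜ A₀ Aₛ Aₜ Aₛₜ * W₀)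
      = 2 * hessT (Ghat m a ((m + 1) * p)) Bₛ Bₜ Bₛₜ
        + 2 * hessT ((((m : ℝ) + 1) ^ 4)⁻¹ • CsqHat m a p)
            (-(Q * GG * (Lₛ * M₀ + M₀ * Bₛ) * GG * Qᵀ))
            (-(Q * GG * (Lₜ * M₀ + M₀ * Bₜ) * GG * Qᵀ))
            (-(Q * GG * (Lₛₜ * M₀ + Lₛ * Bₜ + Lₜ * Bₛ + M₀ * Bₛₜ) * GG * Qᵀ)
              + Q * GG * (Lₛ * M₀ + M₀ * Bₛ) * GG * (Lₜ * M₀ + M₀ * Bₜ) * GG * Qᵀ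
              + Q * GG * (Lₜ * M₀ + M₀ * Bₜ) * GG * (Lₛ * M₀ + M₀ * Bₛ) * GG * Qᵀ)
        - hessT ((((m : ℝ) + 1) ^ 4)⁻¹ • CsqHat m a p)
            (-(Q * GG * (Lₛ * M₀ + M₀ * Lₛ) * GG * Qᵀ))
            (-(Q * GG * (Lₜ * M₀ + M₀ * Lₜ) * GG * Qᵀ))
            (-(Q * GG * (Lₛₜ * M₀ + Lₛ * Lₜ + Lₜ * Lₛ + M₀ * Lₛₜ) * GG * Qᵀ)
              + Q * GG * (Lₛ * M₀ + M₀ * Lₛ) * GG * (Lₜ * M₀ + M₀ * Lₜ) * GG * Qᵀ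
              + Q * GG * (Lₜ * M₀ + M₀ * Lₜ) * GG * (Lₛ * M₀ + M₀ * Lₛ) * GG * Qᵀ) :=
  hessT_ghost_halfCovariant_torus m ha rfl (Nhat r (m + 1) p) (Nhat_range r m p hr) (Nhat_injective r (m + 1) p hr) Dₛ Dₜ Dₛₜ

end Summit.QuantumFields.BalabanUV.Beta.D1BFx.GhostHalfCovariantRoad

end
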